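import Summits.CriticalPhenomena.SAWScalingLimit.Theorems.SAWDefectDecoherencePolygonParitySqueezeDefs
import Summits.CriticalPhenomena.SAWScalingLimit.Theorems.SAWDefectDecoherenceBoundaryClosureRGateMassLaws
import Summits.CriticalPhenomena.SAWScalingLimit.Theorems.DefectDecoherence.Negative.WallExitTwoPoint
import HarnessLib

/-!
# Crux `BoundaryClosureR` (stmt-CriticalPhenomena-14004), line `polygon-parity-squeeze`,
# stub `stub_squeeze`: the BUDGET HALF of the squeeze (mechanism (B))

Landing target:
`Summits/CriticalPhenomena/SAWScalingLimit/Theorems/SAWDefectDecoherenceBoundaryClosureRSqueezeBudget.lean`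
(`--supports stmt-CriticalPhenomena-14004`).

The gate layer budget `GateLayerBudgetAt D r Λ m a b` (`δ Σ_{v ∈ row m δ + k, δ c_v ∈ B(pt 1, r)}
starMass ≤ C (k+1)^{3/4} Z_δ(b_δ)`) passes from an inner family `Λ^P` to the family `Λ` it is
sandwiched in, at the cost of the factor `(1 - ε)⁻¹`, as soon as

* both families carry the SAME exact half-lattice `{v | m δ ≤ v.1 1}` on a ball `B(pt 1, r₂)`,
  `r < r₂` (so the index sets of the two budgets coincide, and so do the stars of their vertices);
* the `σ = 0` masses of `Λ` towards the mid-edges with scaled midpoint in `B(pt 1, r₃)`, `r < r₃`,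
  are at most `(1 - ε)⁻¹` times those of `Λ^P` (collar avoidance + monotonicity), and
  `Z_{Λ^P}(b δ) ≤ Z_Λ(b δ)` (monotonicity).

`starMass_le_of_sandwich` is the one-mesh star comparison, `gateLayerBudget_of_sandwich` the
eventual statement.  Sources: G. Lawler, O. Schramm, W. Werner (2004) §3.4 (restriction);
H. Duminil-Copin, S. Smirnov, Ann. of Math. 175 (2012) §2.  Everything here is proved.
-/

noncomputable section

open scoped BigOperators Topology Classical
open Filter Set
open Literature.Probability.LatticeModels (HexVertex hexGraph hexCenter)
open Literature.Probability.RandomPlanarGeometry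
open Literature.Probability.RandomPlanarGeometry.SAW
open Summit.CriticalPhenomena.SAWScalingLimit.Theorems.PickHalfPlane
open Summit.CriticalPhenomena.SAWScalingLimit.Theorems.ObservableToSLE.FloorRatio
  (dist_hexCenter_hexMidpoint_le)
open Summit.CriticalPhenomena.SAWScalingLimit.Cruxes.DefectDecoherence.TipMartingaleDepthInduction.WallExitTwoPoint
  (dist_hexCenter_le_one_of_adj)

namespace Summit.CriticalPhenomena.SAWScalingLimit.Theorems.PolygonParitySqueeze

/-! ### 1. Lattice distances at mesh `δ` -/

/-- At mesh `0 ≤ δ`: a neighbour of a face with scaled centre in `ball c r` has scaled centre in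
`ball c (r + δ)`. [folklore] -/
theorem smul_hexCenter_adj_mem_ball {δ r : ℝ} {c : ℂ} (hδ : 0 ≤ δ) {v t : HexVertex}
    (h : hexGraph.Adj v t) (hv : (δ : ℂ) * hexCenter v ∈ Metric.ball c r) :
    (δ : ℂ) * hexCenter t ∈ Metric.ball c (r + δ) := by
  rw [Metric.mem_ball] at hv ⊢
  have h1 : dist ((δ : ℂ) * hexCenter t) ((δ : ℂ) * hexCenter v) ≤ δ := by
    rw [Complex.dist_eq, ← mul_sub, norm_mul, Complex.norm_real, Real.norm_of_nonneg hδ,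
      ← Complex.dist_eq]
    have := dist_hexCenter_le_one_of_adj h
    nlinarith
  calc dist ((δ : ℂ) * hexCenter t) c
      ≤ dist ((δ : ℂ) * hexCenter t) ((δ : ℂ) * hexCenter v) + dist ((δ : ℂ) * hexCenter v) c :=
        dist_triangle _ _ _
    _ < r + δ := by linarith

/-- At mesh `0 ≤ δ`: the mid-edge `s(v, t)` of a neighbour `t` of a face `v` with scaled centre in
`ball c r` has scaled midpoint in `ball c (r + δ / 2)`. [folklore] -/
theorem smul_hexMidpoint_adj_mem_ball {δ r : ℝ} {c : ℂ} (hδ : 0 ≤ δ) {v t : HexVertex}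
    (h : hexGraph.Adj v t) (hv : (δ : ℂ) * hexCenter v ∈ Metric.ball c r) :
    (δ : ℂ) * hexMidpoint s(v, t) ∈ Metric.ball c (r + δ / 2) := by
  rw [Metric.mem_ball] at hv ⊢
  have h1 : dist ((δ : ℂ) * hexMidpoint s(v, t)) ((δ : ℂ) * hexCenter v) ≤ δ / 2 := by
    rw [Complex.dist_eq, ← mul_sub, norm_mul, Complex.norm_real, Real.norm_of_nonneg hδ,
      ← Complex.dist_eq, dist_comm]
    have := dist_hexCenter_hexMidpoint_le ((SimpleGraph.mem_edgeSet hexGraph).2 h)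
      (Sym2.mem_mk_left v t)
    nlinarith
  calc dist ((δ : ℂ) * hexMidpoint s(v, t)) c
      ≤ dist ((δ : ℂ) * hexMidpoint s(v, t)) ((δ : ℂ) * hexCenter v) + dist ((δ : ℂ) * hexCenter v) c :=
        dist_triangle _ _ _
    _ < r + δ / 2 := by linarith

/-! ### 2. Star masses of sandwiched families -/

/-- **The star of a gate vertex is the same in both families.** If `Λ` and `Λ'` carry the same
exact half-lattice on `ball c r₂` and `v` has scaled centre in `ball c r` with `r + δ ≤ r₂`, then
the neighbours of `v` in `Λ` and in `Λ'` coincide. [folklore] -/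
theorem filter_adj_eq_of_pins {Λ Λ' : Finset HexVertex} {m : ℤ} {δ r r₂ : ℝ} {c : ℂ} (hδ : 0 ≤ δ)
    (hr : r + δ ≤ r₂)
    (hpin : ∀ w : HexVertex, (δ : ℂ) * hexCenter w ∈ Metric.ball c r₂ → (w ∈ Λ ↔ m ≤ w.1 1))
    (hpin' : ∀ w : HexVertex, (δ : ℂ) * hexCenter w ∈ Metric.ball c r₂ → (w ∈ Λ' ↔ m ≤ w.1 1))
    {v : HexVertex} (hv : (δ : ℂ) * hexCenter v ∈ Metric.ball c r) :
    Λ.filter (fun t => hexGraph.Adj v t) = Λ'.filter (fun t => hexGraph.Adj v t) := by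
  ext t
  simp only [Finset.mem_filter]
  constructor
  · rintro ⟨ht, hadj⟩
    have hball := Metric.ball_subset_ball hr (smul_hexCenter_adj_mem_ball hδ hadj hv)
    exact ⟨(hpin' t hball).2 ((hpin t hball).1 ht), hadj⟩
  · rintro ⟨ht, hadj⟩
    have hball := Metric.ball_subset_ball hr (smul_hexCenter_adj_mem_ball hδ hadj hv)
    exact ⟨(hpin t hball).2 ((hpin' t hball).1 ht), hadj⟩

/-- **Star comparison (one mesh).** Same pins on `ball c r₂`, `r + δ ≤ r₂`; the masses of `Λ`
towards mid-edges of `Ω(Λ)` with scaled midpoint in `ball c r₃`, `r + δ/2 ≤ r₃`, are at most `M`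
times those of `Λ'`, `0 ≤ M`.  Then for every `v ∈ Λ` with scaled centre in `ball c r`,
`starMass Λ a v ≤ M · starMass Λ' a v`. [cite: LawlerSchrammWerner2004SAW, §3.4 (restriction)] -/
theorem starMass_le_of_sandwich {Λ Λ' : Finset HexVertex} {m : ℤ} {δ r r₂ r₃ M : ℝ} {c : ℂ}
    {a : Sym2 HexVertex} (hδ : 0 ≤ δ) (hr : r + δ ≤ r₂) (hr₃ : r + δ / 2 ≤ r₃)
    (hpin : ∀ w : HexVertex, (δ : ℂ) * hexCenter w ∈ Metric.ball c r₂ → (w ∈ Λ ↔ m ≤ w.1 1))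
    (hpin' : ∀ w : HexVertex, (δ : ℂ) * hexCenter w ∈ Metric.ball c r₂ → (w ∈ Λ' ↔ m ≤ w.1 1))
    (hmass : ∀ z ∈ hexDomainMidEdges Λ, (δ : ℂ) * hexMidpoint z ∈ Metric.ball c r₃ →
      ‖hexParafermionicObservable Λ a hexCriticalFugacity 0 z‖ ≤
        M * ‖hexParafermionicObservable Λ' a hexCriticalFugacity 0 z‖)
    {v : HexVertex} (hvΛ : v ∈ Λ) (hv : (δ : ℂ) * hexCenter v ∈ Metric.ball c r) :
    starMass Λ a v ≤ M * starMass Λ' a v := by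
  unfold starMass
  rw [filter_adj_eq_of_pins hδ hr hpin hpin' hv, Finset.mul_sum]
  refine Finset.sum_le_sum fun t ht => ?_
  have hadj : hexGraph.Adj v t := (Finset.mem_filter.1 ht).2
  refine hmass _ ⟨(SimpleGraph.mem_edgeSet hexGraph).2 hadj, v, Sym2.mem_mk_left v t, hvΛ⟩ ?_
  exact Metric.ball_subset_ball hr₃ (smul_hexMidpoint_adj_mem_ball hδ hadj hv)

/-- **Layer sums of sandwiched families (one mesh).** Under the hypotheses of
`starMass_le_of_sandwich`, for every row index `n` the gate layer sum of `Λ` over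
`{v ∈ Λ | δ c_v ∈ ball c r, v.1 1 = n}` is at most `M` times that of `Λ'` (the two index sets
coincide by the pins). [cite: LawlerSchrammWerner2004SAW, §3.4 (restriction)] -/
theorem layerSum_le_of_sandwich {Λ Λ' : Finset HexVertex} {m n : ℤ} {δ r r₂ r₃ M : ℝ} {c : ℂ}
    {a : Sym2 HexVertex} (hδ : 0 ≤ δ) (hr : r + δ ≤ r₂) (hr₃ : r + δ / 2 ≤ r₃)
    (hpin : ∀ w : HexVertex, (δ : ℂ) * hexCenter w ∈ Metric.ball c r₂ → (w ∈ Λ ↔ m ≤ w.1 1))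
    (hpin' : ∀ w : HexVertex, (δ : ℂ) * hexCenter w ∈ Metric.ball c r₂ → (w ∈ Λ' ↔ m ≤ w.1 1))
    (hmass : ∀ z ∈ hexDomainMidEdges Λ, (δ : ℂ) * hexMidpoint z ∈ Metric.ball c r₃ →
      ‖hexParafermionicObservable Λ a hexCriticalFugacity 0 z‖ ≤
        M * ‖hexParafermionicObservable Λ' a hexCriticalFugacity 0 z‖) :
    ∑ᶠ v ∈ {v : HexVertex | v ∈ Λ ∧ (δ : ℂ) * hexCenter v ∈ Metric.ball c r ∧ v.1 1 = n},
        starMass Λ a v ≤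
      M * ∑ᶠ v ∈ {v : HexVertex | v ∈ Λ' ∧ (δ : ℂ) * hexCenter v ∈ Metric.ball c r ∧ v.1 1 = n},
        starMass Λ' a v := by
  have hδr : r ≤ r₂ := by linarith
  -- the two index sets coincide
  have hset : {v : HexVertex | v ∈ Λ ∧ (δ : ℂ) * hexCenter v ∈ Metric.ball c r ∧ v.1 1 = n} =
      {v : HexVertex | v ∈ Λ' ∧ (δ : ℂ) * hexCenter v ∈ Metric.ball c r ∧ v.1 1 = n} := by
    ext v
    simp only [Set.mem_setOf_eq]
    constructor
    · rintro ⟨hv, hb, hn⟩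
      exact ⟨(hpin' v (Metric.ball_subset_ball hδr hb)).2 ((hpin v (Metric.ball_subset_ball hδr hb)).1 hv),
        hb, hn⟩
    · rintro ⟨hv, hb, hn⟩
      exact ⟨(hpin v (Metric.ball_subset_ball hδr hb)).2 ((hpin' v (Metric.ball_subset_ball hδr hb)).1 hv),
        hb, hn⟩
  have hfin : {v : HexVertex | v ∈ Λ' ∧ (δ : ℂ) * hexCenter v ∈ Metric.ball c r ∧ v.1 1 = n}.Finite :=
    (Λ'.finite_toSet).subset fun v hv => hv.1
  rw [hset, finsum_mem_eq_finite_toFinset_sum _ hfin, finsum_mem_eq_finite_toFinset_sum _ hfin,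
    Finset.mul_sum]
  refine Finset.sum_le_sum fun v hv => ?_
  obtain ⟨hvΛ', hb, -⟩ := hfin.mem_toFinset.1 hv
  have hvΛ : v ∈ Λ := (hpin v (Metric.ball_subset_ball hδr hb)).2 ((hpin' v (Metric.ball_subset_ball hδr hb)).1 hvΛ')
  exact starMass_le_of_sandwich hδ hr hr₃ hpin hpin' hmass hvΛ hb

/-! ### 3. The budget half of the squeeze -/

/-- **Gate layer budget of a sandwiched family.** Let `Λ`, `Λ'` be two families carrying,
eventually, the same exact half-lattice `{m δ ≤ v.1 1}` on `B(pt 1, r₂)`, `r < r₂`; assume that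
eventually the `σ = 0` masses of `Λ δ` (root `a δ`) towards the mid-edges with scaled midpoint in
`B(pt 1, r₃)`, `r < r₃`, are at most `M` times those of `Λ' δ` (`0 ≤ M`; for the squeeze,
`M = (1 - ε)⁻¹` by collar avoidance and monotonicity `collarDomain ⊆ Λ'`), and that
`Z_{Λ'}(b δ) ≤ Z_Λ(b δ)` (monotonicity `Λ' ⊆ Λ`).  Then the gate layer budget on `B(pt 1, r)` passes
from `Λ'` to `Λ`: `GateLayerBudgetAt D r Λ' m a b → GateLayerBudgetAt D r Λ m a b` (constant
`M · max C 0`). [cite: LawlerSchrammWerner2004SAW, §3.4 (restriction / boundary scaling heuristics)] -/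
theorem gateLayerBudget_of_sandwich {D : DobrushinDomain} {r r₂ r₃ M : ℝ}
    {Λ Λ' : ℝ → Finset HexVertex} {m : ℝ → ℤ} {a b : ℝ → Sym2 HexVertex}
    (hr₂ : r < r₂) (hr₃ : r < r₃) (hM : 0 ≤ M)
    (hpin : ∀ᶠ δ : ℝ in 𝓝[>] 0, ∀ w : HexVertex,
      (δ : ℂ) * hexCenter w ∈ Metric.ball (D.pt 1) r₂ → (w ∈ Λ δ ↔ m δ ≤ w.1 1))
    (hpin' : ∀ᶠ δ : ℝ in 𝓝[>] 0, ∀ w : HexVertex,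
      (δ : ℂ) * hexCenter w ∈ Metric.ball (D.pt 1) r₂ → (w ∈ Λ' δ ↔ m δ ≤ w.1 1))
    (hmass : ∀ᶠ δ : ℝ in 𝓝[>] 0, ∀ z ∈ hexDomainMidEdges (Λ δ),
      (δ : ℂ) * hexMidpoint z ∈ Metric.ball (D.pt 1) r₃ →
        ‖hexParafermionicObservable (Λ δ) (a δ) hexCriticalFugacity 0 z‖ ≤
          M * ‖hexParafermionicObservable (Λ' δ) (a δ) hexCriticalFugacity 0 z‖)
    (hnorm : ∀ᶠ δ : ℝ in 𝓝[>] 0,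
      ‖hexParafermionicObservable (Λ' δ) (a δ) hexCriticalFugacity 0 (b δ)‖ ≤
        ‖hexParafermionicObservable (Λ δ) (a δ) hexCriticalFugacity 0 (b δ)‖)
    (hbudget : GateLayerBudgetAt D r Λ' m a b) : GateLayerBudgetAt D r Λ m a b := by
  obtain ⟨C, hC⟩ := hbudget
  refine ⟨M * max C 0, ?_⟩
  have hδ : ∀ᶠ δ : ℝ in 𝓝[>] 0, δ ∈ Set.Ioo 0 (min (r₂ - r) (r₃ - r)) :=
    Ioo_mem_nhdsGT (lt_min (by linarith) (by linarith))
  filter_upwards [hpin, hpin', hmass, hnorm, hC, hδ] with δ hpinδ hpinδ' hmassδ hnormδ hCδ hδ k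
  have hδ0 : 0 < δ := hδ.1
  have h1 : δ < r₂ - r := lt_of_lt_of_le hδ.2 (min_le_left _ _)
  have h2 : δ < r₃ - r := lt_of_lt_of_le hδ.2 (min_le_right _ _)
  have hle := layerSum_le_of_sandwich (r := r) (n := m δ + k) (a := a δ) hδ0.le
    (show r + δ ≤ r₂ by linarith) (show r + δ / 2 ≤ r₃ by linarith) hpinδ hpinδ' hmassδ
  have hk : 0 ≤ ((k : ℝ) + 1) ^ (3 / 4 : ℝ) := by positivity
  set SP := ∑ᶠ v ∈ {v : HexVertex | v ∈ Λ' δ ∧ (δ : ℂ) * hexCenter v ∈ Metric.ball (D.pt 1) r ∧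
      v.1 1 = m δ + k}, starMass (Λ' δ) (a δ) v with hSP
  set ZP := ‖hexParafermionicObservable (Λ' δ) (a δ) hexCriticalFugacity 0 (b δ)‖ with hZP
  set ZΛ := ‖hexParafermionicObservable (Λ δ) (a δ) hexCriticalFugacity 0 (b δ)‖ with hZΛ
  have hCk := hCδ k
  have hZP0 : 0 ≤ ZP := norm_nonneg _
  calc δ * ∑ᶠ v ∈ {v : HexVertex | v ∈ Λ δ ∧ (δ : ℂ) * hexCenter v ∈ Metric.ball (D.pt 1) r ∧
          v.1 1 = m δ + k}, starMass (Λ δ) (a δ) v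
      ≤ δ * (M * SP) := mul_le_mul_of_nonneg_left hle hδ0.le
    _ = M * (δ * SP) := by ring
    _ ≤ M * (C * ((k : ℝ) + 1) ^ (3 / 4 : ℝ) * ZP) := mul_le_mul_of_nonneg_left hCk hM
    _ ≤ M * (max C 0 * ((k : ℝ) + 1) ^ (3 / 4 : ℝ) * ZP) := by
        apply mul_le_mul_of_nonneg_left _ hM
        exact mul_le_mul_of_nonneg_right (mul_le_mul_of_nonneg_right (le_max_left _ _) hk) hZP0
    _ ≤ M * (max C 0 * ((k : ℝ) + 1) ^ (3 / 4 : ℝ) * ZΛ) := by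
        apply mul_le_mul_of_nonneg_left _ hM
        exact mul_le_mul_of_nonneg_left hnormδ (mul_nonneg (le_max_right _ _) hk)
    _ = M * max C 0 * ((k : ℝ) + 1) ^ (3 / 4 : ℝ) * ZΛ := by ring

/-! ### Registered form (sub-goal of `stub_squeeze`) -/

/-- **Registered sub-goal `squeeze_budgetTransfer`** (crux item stmt-CriticalPhenomena-14004, line
`polygon-parity-squeeze`, stub `stub_squeeze`): the budget half of the squeeze — the gate layer
budget on `B(pt 1, r)` passes from an inner family `Λ'` (same exact half-lattice on `B(pt 1, r₂)`,
`r < r₂`; masses of `Λ` towards targets in `B(pt 1, r₃)`, `r < r₃`, at most `M` times those of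
`Λ'`; `Z_{Λ'}(b δ) ≤ Z_Λ(b δ)`) to the family `Λ`.
[cite: LawlerSchrammWerner2004SAW, §3.4 (restriction / boundary scaling heuristics)] -/
theorem squeeze_budgetTransfer : ∀ (D : DobrushinDomain) (r r₂ r₃ M : ℝ) (Λ Λ' : ℝ → Finset HexVertex) (m : ℝ → ℤ) (a b : ℝ → Sym2 HexVertex), r < r₂ → r < r₃ → 0 ≤ M → (∀ᶠ δ : ℝ in 𝓝[>] 0, ∀ w : HexVertex, (δ : ℂ) * hexCenter w ∈ Metric.ball (D.pt 1) r₂ → (w ∈ Λ δ ↔ m δ ≤ w.1 1)) → (∀ᶠ δ : ℝ in 𝓝[>] 0, ∀ w : HexVertex, (δ : ℂ) * hexCenter w ∈ Metric.ball (D.pt 1) r₂ → (w ∈ Λ' δ ↔ m δ ≤ w.1 1)) → (∀ᶠ δ : ℝ in 𝓝[>] 0, ∀ z ∈ hexDomainMidEdges (Λ δ), (δ : ℂ) * hexMidpoint z ∈ Metric.ball (D.pt 1) r₃ → ‖hexParafermionicObservable (Λ δ) (a δ) hexCriticalFugacity 0 z‖ ≤ M * ‖hexParafermionicObservable (Λ'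 δ) (a δ) hexCriticalFugacity 0 z‖) → (∀ᶠ δ : ℝ in 𝓝[>] 0, ‖hexParafermionicObservable (Λ' δ) (a δ) hexCriticalFugacity 0 (b δ)‖ ≤ ‖hexParafermionicObservable (Λ δ) (a δ) hexCriticalFugacity 0 (b δ)‖) → GateLayerBudgetAt D r Λ' m a b → GateLayerBudgetAt D r Λ m a b :=
  fun _ _ _ _ _ _ _ _ _ _ hr₂ hr₃ hM hpin hpin' hmass hnorm hbudget =>
    gateLayerBudget_of_sandwich hr₂ hr₃ hM hpin hpin' hmass hnorm hbudget

end Summit.CriticalPhenomena.SAWScalingLimit.Theorems.PolygonParitySqueeze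

end
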